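import Summits.NavierStokesRegularity.NavierStokesRegularity.Theorems.TypeIIInviscidRelaxationAxisymSwirlRegularInflowCriticalFloor
import HarnessLib

/-!
# Crux `AprioriRadialInflowBound` (stmt-NavierStokesRegularity-19060 = piece X₂ of `AxisymSwirlRegular`,
# stmt-NavierStokesRegularity-1964), line `supercritical_defect_floor`: the registered assembly stub
# `stub_minPrinciple_sublevel` BY NAME

`--supports stmt-NavierStokesRegularity-19060` (stub credit; theorems only, no definitions, no `sorry`).

The registered line `Cruxes/AprioriRadialInflowBound/Lines/supercritical_defect_floor.lean` cuts the a-priori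
one-sided radial inflow bound (`Φ = x₀u₀ + x₁u₁ = r u_r ≥ -Cν` on an axis tube, standing axisymmetric class)
into

* `stub_minPrinciple_sublevel` [assembly]: the radial-momentum minimum principle with the floor for the
  cyclostrophic defect `u₀² + u₁² - (x₀∂₀p + x₁∂₁p) ≥ -g(t)` asked ONLY at off-axis spatial critical points
  of `Φ(t,·)` with `ΔΦ ≥ 0` lying in the supercritical sub-level set `{Φ ≤ -C₀ν}`;
* `stub_supercriticalDefectFloor` [research]: such a floor holds in the standing class.

This file proves the first one, signature verbatim. The proof is the tree engine
`radialMomentum_minPrinciple_engine_critical` (`…InflowCriticalFloor.lean`) re-run through the Literature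
weak maximum principle ON THE POSITIVITY SET (`weak_max_principle_of_contDiffAt_of_pos`, Lieberman 1996
Ch. II Lemma 2.1: the differential inequality is consumed only at a point of positive maximum of the
comparison function). With the comparison function `w = -Φ - ∫₀ˢ g⁺ - B`, `B = max(δ₁M, L)`, positivity
`w > 0` at the touching point says `Φ < -B ≤ -L`, so a floor asked only on `{Φ ≤ -L}` suffices; the
boundary inequalities only need `B ≥ δ₁M`.

* `radialMomentum_minPrinciple_engine_sublevel` — the engine with the floor on the sub-level set `{Φ ≤ -L}`;
* `inflowBound_of_sublevelDefectFloor` — the a-priori inflow bound on `{cylRadius < δ/2} × [0,T)` from it;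
* `SupercriticalDefectFloor.stub_minPrinciple_sublevel` — the registered stub, verbatim.

HONEST FRAMING: this closes the ASSEMBLY half of the line; the research half `stub_supercriticalDefectFloor`
(a one-sided a-priori pressure statement at the strongest supercritical inflow points) is open, and with it
`AprioriRadialInflowBound`, `AxisymSwirlRegular` and everything above. Nothing about Navier–Stokes regularity
is claimed.

References: G. M. Lieberman, *Second order parabolic differential equations*, World Scientific 1996, Ch. II
Lemma 2.1, Lemma 2.3 [Lieberman1996].
-/

noncomputable section

open Literature.Analysis.FluidPDE MeasureTheory Set Function Filter Topology Metric WithLp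
open scoped InnerProductSpace RealInnerProductSpace Laplacian ContDiff

namespace Summit.NavierStokesRegularity.NavierStokesRegularity.Theorems

-- the problem directory repeats the summit name (`NavierStokesRegularity/NavierStokesRegularity`)
set_option linter.dupNamespace false

/-- **The radial-momentum minimum principle with the defect floor on a sub-level set (the engine).**
Standing class `AxisymmetricL3Hyp`; `K = B̄(0,R) ∩ {r ≤ δ₁}`, `U = B(0,R) ∩ {r < δ₁}`. If `|u| ≤ M` on
`K ∖ U` for `t ∈ [0,T)` and on `K` at `t = 0`, and the cyclostrophic defect
`u₀² + u₁² − (x₀∂₀p + x₁∂₁p)` is `≥ −g(t)` (`g ≥ 0` continuous on `[0,T)`, `∫₀ᵗ g ≤ I`) at every off-axis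
point of `U` which is a spatial critical point of `Φ(t,·) = x₀u₀ + x₁u₁` with `ΔΦ ≥ 0` AND `Φ ≤ −L`,
then `Φ ≥ −(max(δ₁M, L) + I)` on `K × [0,T)`. Proof: `weak_max_principle_of_contDiffAt_of_pos` on
`[0,t] × K` for `w = −Φ − ∫₀ˢ g − max(δ₁M, L)`; where `w > 0` one has `Φ < −max(δ₁M, L) ≤ −L`, so the
restricted floor applies; at an interior critical point of `Φ(s,·)` with `ΔΦ ≥ 0`, `∂ₜΦ = 0` on the axis
and `∂ₜΦ = νΔΦ + defect ≥ −g(s)` off it; on the parabolic boundary `Φ ≥ −r|u| ≥ −δ₁M ≥ −max(δ₁M, L)`.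
[new; method: Lieberman 1996 Ch. II Lemma 2.1 on the positivity set] -/
theorem radialMomentum_minPrinciple_engine_sublevel {ν T : ℝ} {u : ℝ → EuclideanSpace ℝ (Fin 3) → EuclideanSpace ℝ (Fin 3)} {p : ℝ → EuclideanSpace ℝ (Fin 3) → ℝ}
    (H : AxisymmetricL3Hyp ν T u p) {δ₁ R M I L : ℝ}
    {g : ℝ → ℝ} (hgc : ContinuousOn g (Ico 0 T)) (hg0 : ∀ t ∈ Ico 0 T, 0 ≤ g t)
    (hgI : ∀ t ∈ Ico 0 T, ∫ s in (0:ℝ)..t, g s ≤ I)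
    (hfloor : ∀ t ∈ Ico 0 T, ∀ x ∈ ball (0 : EuclideanSpace ℝ (Fin 3)) R ∩ {x | cylRadius x < δ₁},
      cylRadius x ≠ 0 →
      x 0 * u t x 0 + x 1 * u t x 1 ≤ -L →
      fderiv ℝ (fun z : EuclideanSpace ℝ (Fin 3) => z 0 * u t z 0 + z 1 * u t z 1) x = 0 →
      0 ≤ (Δ (fun z : EuclideanSpace ℝ (Fin 3) => z 0 * u t z 0 + z 1 * u t z 1)) x →
      -g t ≤ (u t x 0) ^ 2 + (u t x 1) ^ 2
        - (x 0 * fderiv ℝ (p t) x (EuclideanSpace.single 0 1)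
            + x 1 * fderiv ℝ (p t) x (EuclideanSpace.single 1 1)))
    (hlat : ∀ t ∈ Ico 0 T, ∀ x ∈ (closedBall (0 : EuclideanSpace ℝ (Fin 3)) R ∩ {x | cylRadius x ≤ δ₁}) \
      (ball (0 : EuclideanSpace ℝ (Fin 3)) R ∩ {x | cylRadius x < δ₁}), ‖u t x‖ ≤ M)
    (hbot : ∀ x ∈ closedBall (0 : EuclideanSpace ℝ (Fin 3)) R ∩ {x | cylRadius x ≤ δ₁}, ‖u 0 x‖ ≤ M) :
    ∀ t ∈ Ico 0 T, ∀ x ∈ closedBall (0 : EuclideanSpace ℝ (Fin 3)) R ∩ {x | cylRadius x ≤ δ₁},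
      -(max (δ₁ * M) L + I) ≤ x 0 * u t x 0 + x 1 * u t x 1 := by
  intro t ht x hx
  set K : Set (EuclideanSpace ℝ (Fin 3)) := closedBall (0 : EuclideanSpace ℝ (Fin 3)) R ∩ {x | cylRadius x ≤ δ₁} with hK_def
  set U : Set (EuclideanSpace ℝ (Fin 3)) := ball (0 : EuclideanSpace ℝ (Fin 3)) R ∩ {x | cylRadius x < δ₁} with hU_def
  set B : ℝ := max (δ₁ * M) L with hB_def
  set G : ℝ → ℝ := fun s => ∫ τ in (0:ℝ)..s, g τ with hG_def
  set w : ℝ → EuclideanSpace ℝ (Fin 3) → ℝ := fun s y => -(y 0 * u s y 0 + y 1 * u s y 1) - G s - B with hw_def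
  set wt : ℝ → EuclideanSpace ℝ (Fin 3) → ℝ := fun s y =>
    -(y 0 * timeDerivWithin (Ico 0 T) u s y 0 + y 1 * timeDerivWithin (Ico 0 T) u s y 1) - g s
    with hwt_def
  have hν := H.viscosity_pos
  have hsm := H.classical.smooth_velocity
  have htT : Icc 0 t ⊆ Ico 0 T := fun s hs => ⟨hs.1, hs.2.trans_lt ht.2⟩
  have hBM : δ₁ * M ≤ B := le_max_left _ _
  have hBL : L ≤ B := le_max_right _ _
  -- the radial momentum against a velocity bound on `K`
  have hΦbd : ∀ (s : ℝ) (y : EuclideanSpace ℝ (Fin 3)), y ∈ K → ‖u s y‖ ≤ M →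
      -(δ₁ * M) ≤ y 0 * u s y 0 + y 1 * u s y 1 := fun s y hy hMy =>
    radialMomentum_ge_neg_mul_of_norm_le hy.2 hMy
  -- the time integral of the floor
  have hG0 : G 0 = 0 := intervalIntegral.integral_same
  have hGnn : ∀ s ∈ Icc 0 t, 0 ≤ G s := fun s hs =>
    intervalIntegral.integral_nonneg hs.1 fun τ hτ => hg0 τ ⟨hτ.1, hτ.2.trans_lt (hs.2.trans_lt ht.2)⟩
  -- the sets
  have hK : IsCompact K :=
    (isCompact_closedBall _ _).inter_right (isClosed_le continuous_cylRadius continuous_const)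
  have hU : IsOpen U := isOpen_ball.inter (isOpen_lt continuous_cylRadius continuous_const)
  have hUK : U ⊆ K := fun y hy =>
    ⟨ball_subset_closedBall hy.1, (le_of_lt (hy.2 : cylRadius y < δ₁) : cylRadius y ≤ δ₁)⟩
  -- joint continuity of `w` on `[0,t] × K`
  have hc : ContinuousOn (uncurry w) (Icc 0 t ×ˢ K) := by
    have hu : ContinuousOn (uncurry u) (Icc 0 t ×ˢ K) :=
      hsm.continuousOn.mono (prod_mono htT (subset_univ _))
    have h0 : ContinuousOn (fun q : ℝ × EuclideanSpace ℝ (Fin 3) => uncurry u q 0) (Icc 0 t ×ˢ K) :=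
      (EuclideanSpace.proj (0 : Fin 3)).continuous.comp_continuousOn hu
    have h1 : ContinuousOn (fun q : ℝ × EuclideanSpace ℝ (Fin 3) => uncurry u q 1) (Icc 0 t ×ˢ K) :=
      (EuclideanSpace.proj (1 : Fin 3)).continuous.comp_continuousOn hu
    have hy0 : Continuous (fun q : ℝ × EuclideanSpace ℝ (Fin 3) => q.2 0) := (EuclideanSpace.proj (0 : Fin 3)).continuous.comp continuous_snd
    have hy1 : Continuous (fun q : ℝ × EuclideanSpace ℝ (Fin 3) => q.2 1) := (EuclideanSpace.proj (1 : Fin 3)).continuous.comp continuous_snd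
    have hGc : ContinuousOn G (Icc 0 t) := by
      have hint : IntegrableOn g (uIcc 0 t) := by
        rw [uIcc_of_le ht.1]
        exact (hgc.mono htT).integrableOn_compact isCompact_Icc
      have := intervalIntegral.continuousOn_primitive_interval (μ := volume) hint
      rwa [uIcc_of_le ht.1] at this
    have hGc' : ContinuousOn (fun q : ℝ × EuclideanSpace ℝ (Fin 3) => G q.1) (Icc 0 t ×ˢ K) :=
      hGc.comp continuous_fst.continuousOn fun q hq => hq.1
    have e : uncurry w = fun q : ℝ × EuclideanSpace ℝ (Fin 3) =>
        -(q.2 0 * uncurry u q 0 + q.2 1 * uncurry u q 1) - G q.1 - B := by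
      funext q
      rfl
    rw [e]
    exact ((((hy0.continuousOn.mul h0).add (hy1.continuousOn.mul h1)).neg.sub hGc').sub
      continuousOn_const)
  -- slice regularity
  have h2 : ∀ s ∈ Ioc 0 t, ∀ y ∈ U, ContDiffAt ℝ 2 (w s) y := by
    intro s hs y _
    have hs' : s ∈ Ico 0 T := ⟨hs.1.le, hs.2.trans_lt ht.2⟩
    have hU2 : ContDiff ℝ 2 (u s) := (H.classical.contDiff_velocity hs').of_le (by norm_cast)
    exact (((contDiff_radialMomentum hU2).neg.sub contDiff_const).sub contDiff_const).contDiffAt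
  -- the left time derivative
  have hderiv : ∀ s ∈ Ioc 0 t, ∀ y ∈ U,
      HasDerivWithinAt (fun τ => w τ y) (wt s y) (Icc 0 s) s := by
    intro s hs y _
    have hs' : s ∈ Ico 0 T := ⟨hs.1.le, hs.2.trans_lt ht.2⟩
    have hsT : s ∈ Ioo 0 T := ⟨hs.1, hs.2.trans_lt ht.2⟩
    have hΦ := (hasDerivWithinAt_radialMomentum hsm hs' y).mono
      (show Icc 0 s ⊆ Ico 0 T from fun τ hτ => ⟨hτ.1, hτ.2.trans_lt hsT.2⟩)
    have hgs : ContinuousAt g s :=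
      (hgc.mono Ioo_subset_Ico_self).continuousAt (isOpen_Ioo.mem_nhds hsT)
    have hmeas : StronglyMeasurableAtFilter g (𝓝 s) volume :=
      (hgc.mono Ioo_subset_Ico_self).stronglyMeasurableAtFilter isOpen_Ioo _ hsT
    have hii : IntervalIntegrable g volume 0 s := by
      refine (hgc.mono ?_).intervalIntegrable
      rw [uIcc_of_le hs.1.le]
      exact fun τ hτ => ⟨hτ.1, hτ.2.trans_lt hsT.2⟩
    have hG : HasDerivAt G (g s) s := intervalIntegral.integral_hasDerivAt_right hii hmeas hgs
    exact (hΦ.neg.sub hG.hasDerivWithinAt).sub_const B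
  -- the sub-solution property at interior critical points OF THE POSITIVITY SET
  have hsub : ∀ s ∈ Ioc 0 t, ∀ y ∈ U, 0 < w s y → fderiv ℝ (w s) y = 0 → (Δ (w s)) y ≤ 0 →
      wt s y ≤ 0 := by
    intro s hs y hy hpos hgrad hlap
    have hs' : s ∈ Ico 0 T := ⟨hs.1.le, hs.2.trans_lt ht.2⟩
    have hU2 : ContDiff ℝ 2 (u s) := (H.classical.contDiff_velocity hs').of_le (by norm_cast)
    have hΦ2 : ContDiff ℝ 2 (fun z : EuclideanSpace ℝ (Fin 3) => z 0 * u s z 0 + z 1 * u s z 1) :=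
      contDiff_radialMomentum hU2
    have hw_eq : w s = fun z => -(z 0 * u s z 0 + z 1 * u s z 1) - (G s + B) := by
      funext z
      simp only [hw_def]
      ring
    have hgradΦ : fderiv ℝ (fun z : EuclideanSpace ℝ (Fin 3) => z 0 * u s z 0 + z 1 * u s z 1) y = 0 := by
      have e : fderiv ℝ (w s) y = -fderiv ℝ (fun z : EuclideanSpace ℝ (Fin 3) => z 0 * u s z 0 + z 1 * u s z 1) y := by
        rw [hw_eq, fderiv_sub_const, fderiv_fun_neg]
      rw [e] at hgrad
      exact neg_eq_zero.1 hgrad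
    have hlapΦ : 0 ≤ (Δ (fun z : EuclideanSpace ℝ (Fin 3) => z 0 * u s z 0 + z 1 * u s z 1)) y := by
      have e : (Δ (w s)) y = -(Δ (fun z : EuclideanSpace ℝ (Fin 3) => z 0 * u s z 0 + z 1 * u s z 1)) y := by
        rw [hw_eq]
        exact laplacian_neg_sub_const hΦ2 _ y
      rw [e] at hlap
      linarith
    -- positivity of `w` puts the point in the sub-level set `{Φ ≤ -L}`
    have hlevel : y 0 * u s y 0 + y 1 * u s y 1 ≤ -L := by
      have hGs : 0 ≤ G s := hGnn s ⟨hs.1.le, hs.2⟩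
      have hw : w s y = -(y 0 * u s y 0 + y 1 * u s y 1) - G s - B := rfl
      rw [hw] at hpos
      linarith
    have hg0s := hg0 s hs'
    by_cases hax : cylRadius y = 0
    · obtain ⟨h0, h1⟩ := (cylRadius_eq_zero_iff y).1 hax
      simp only [hwt_def, h0, h1, zero_mul, add_zero, neg_zero, zero_sub]
      linarith
    · have hUD : UniqueDiffWithinAt ℝ (Ico 0 T) s := uniqueDiffOn_Ico 0 T s hs'
      have hcrit := timeDerivWithin_radialMomentum_of_critical H.classical hs' hUD
        (H.axisymmetric s hs') hax hgradΦ
      have e := timeDerivWithin_radialMomentum hsm hs' hUD y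
      have hfl := hfloor s hs' y hy hax hlevel hgradΦ hlapΦ
      have hνΔ : 0 ≤ ν * (Δ (fun z : EuclideanSpace ℝ (Fin 3) => z 0 * u s z 0 + z 1 * u s z 1)) y :=
        mul_nonneg hν.le hlapΦ
      simp only [hwt_def]
      rw [← e, hcrit]
      simp only [Pi.zero_apply, PiLp.zero_apply, mul_zero, add_zero]
      linarith
  -- the parabolic boundary
  have hbot' : ∀ y ∈ K, w 0 y ≤ 0 := by
    intro y hy
    have h := hΦbd 0 y hy (hbot y hy)
    simp only [hw_def, hG0]
    linarith
  have hlat' : ∀ s ∈ Icc 0 t, ∀ y ∈ K \ U, w s y ≤ 0 := by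
    intro s hs y hy
    have h := hΦbd s y hy.1 (hlat s (htT hs) y hy)
    have hG := hGnn s hs
    simp only [hw_def]
    linarith
  -- the weak maximum principle on the positivity set
  have key := weak_max_principle_of_contDiffAt_of_pos hK hU hUK hc h2 hderiv hsub hbot' hlat' t
    ⟨ht.1, le_rfl⟩ x hx
  have hGI : G t ≤ I := hgI t ht
  simp only [hw_def] at key
  linarith

/-- **A-priori inflow bound from a floor at the SUPERCRITICAL strongest-inflow points.** In the standing
class (`AxisymmetricL3Hyp`: classical on `[0,T)`, Leray–Hopf, bounded on sub-slabs, axisymmetric slices),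
suppose there are a level `C₀`, a tube radius `δ > 0` and `g` continuous and integrable on `[0,T)` such that
at every time `t` and every point `x` of the axis tube `{0 < cylRadius < δ}` which is a spatial critical
point of `Φ(t,·) = x₀u₀ + x₁u₁` with `ΔΦ(t,x) ≥ 0` and `Φ(t,x) ≤ −C₀ν` (an instantaneous point of strongest
supercritical inflow), the cyclostrophic defect satisfies `u₀² + u₁² − (x₀∂₀p + x₁∂₁p) ≥ −g(t)`. Then
`Φ ≥ −Cν` on `{cylRadius < δ/2} × [0,T)` with `C = (max(δM/2, C₀ν) + ∫_{[0,T)} g⁺)/ν`, `M` a velocity bound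
off the half tube / in the far field / on an early slab (tree: `bounded_offTube`,
`axisymmetricL3_boundedNearTop_infinity`, `bounded_subslab`). This weakens the hypothesis of the tree's
`inflowBound_of_criticalDefectFloor` from all levels to the sub-level set `{Φ ≤ −C₀ν}`. [new] -/
theorem inflowBound_of_sublevelDefectFloor {ν T : ℝ}
    {u : ℝ → EuclideanSpace ℝ (Fin 3) → EuclideanSpace ℝ (Fin 3)} {p : ℝ → EuclideanSpace ℝ (Fin 3) → ℝ}
    (H : AxisymmetricL3Hyp ν T u p) {C₀ δ : ℝ} (hδ : 0 < δ) {g : ℝ → ℝ}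
    (hgc : ContinuousOn g (Ico 0 T)) (hgi : IntegrableOn g (Ico 0 T))
    (hfl : ∀ t ∈ Ico 0 T, ∀ x, cylRadius x < δ → cylRadius x ≠ 0 →
      x 0 * u t x 0 + x 1 * u t x 1 ≤ -(C₀ * ν) →
      fderiv ℝ (fun z : EuclideanSpace ℝ (Fin 3) => z 0 * u t z 0 + z 1 * u t z 1) x = 0 →
      0 ≤ (Δ (fun z : EuclideanSpace ℝ (Fin 3) => z 0 * u t z 0 + z 1 * u t z 1)) x →
      -g t ≤ (u t x 0) ^ 2 + (u t x 1) ^ 2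
        - (x 0 * fderiv ℝ (p t) x (EuclideanSpace.single 0 1)
            + x 1 * fderiv ℝ (p t) x (EuclideanSpace.single 1 1))) :
    ∃ C δ' : ℝ, 0 < δ' ∧ ∀ t ∈ Ico 0 T, ∀ x, cylRadius x < δ' →
      -(C * ν) ≤ x 0 * u t x 0 + x 1 * u t x 1 := by
  have hν := H.viscosity_pos
  have hT := H.time_pos
  have hbd := H.bounded_subslab
  have hδ2 : 0 < δ / 2 := half_pos hδ
  /- (a) velocity bounds: off the half-tube, in the far field, initially -/
  obtain ⟨R₀, r₁, K₁, hr₁, hfar⟩ := axisymmetricL3_boundedNearTop_infinity H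
  obtain ⟨r₀, hr₀, M₀, hM₀⟩ := H.bounded_offTube hδ2
  have hρ : 0 < min r₀ r₁ := lt_min hr₀ hr₁
  have hρ2 : 0 < min r₀ r₁ ^ 2 := pow_pos hρ 2
  set T' : ℝ := max (T - min r₀ r₁ ^ 2 / 2) 0 with hT'_def
  have hT'T : T' < T := max_lt (by linarith) hT
  obtain ⟨B, hB⟩ := hbd T' hT'T
  set R : ℝ := max R₀ 0 with hR_def
  set M : ℝ := max (max M₀ K₁) B with hM_def
  have h0T' : (0 : ℝ) ∈ Icc 0 T' := ⟨le_rfl, le_max_right _ _⟩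
  have hslab : ∀ t ∈ Ico 0 T, t ≤ T - min r₀ r₁ ^ 2 → ∀ x, ‖u t x‖ ≤ M := by
    intro t ht hle x
    have htI : t ∈ Icc 0 T' := ⟨ht.1, le_trans (by linarith) (le_max_left _ _)⟩
    exact (hB t htI x).trans (le_max_right _ _)
  have hr₀ρ : min r₀ r₁ ^ 2 ≤ r₀ ^ 2 := pow_le_pow_left₀ hρ.le (min_le_left _ _) 2
  have hr₁ρ : min r₀ r₁ ^ 2 ≤ r₁ ^ 2 := pow_le_pow_left₀ hρ.le (min_le_right _ _) 2
  have htube : ∀ t ∈ Ico 0 T, ∀ x, δ / 2 ≤ cylRadius x → ‖u t x‖ ≤ M := by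
    intro t ht x hx
    by_cases hlt : T - r₀ ^ 2 < t
    · exact (hM₀ t ⟨hlt, ht.2⟩ x hx).trans ((le_max_left _ _).trans (le_max_left _ _))
    · push Not at hlt
      exact hslab t ht (hlt.trans (by linarith)) x
  have hfarM : ∀ t ∈ Ico 0 T, ∀ x, R ≤ ‖x‖ → ‖u t x‖ ≤ M := by
    intro t ht x hx
    have hx' : R₀ ≤ ‖x‖ := (le_max_left _ _).trans hx
    by_cases hlt : T - r₁ ^ 2 < t
    · exact (hfar t ⟨hlt, ht.2⟩ x hx').trans ((le_max_right _ _).trans (le_max_left _ _))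
    · push Not at hlt
      exact hslab t ht (hlt.trans (by linarith)) x
  have hinit : ∀ x, ‖u 0 x‖ ≤ M := fun x => (hB 0 h0T' x).trans (le_max_right _ _)
  /- (b) the floor `g⁺` -/
  set gp : ℝ → ℝ := fun t => max (g t) 0 with hgp_def
  have hgpc : ContinuousOn gp (Ico 0 T) := fun t ht => (hgc t ht).max continuousWithinAt_const
  have hgp0 : ∀ t ∈ Ico 0 T, 0 ≤ gp t := fun t _ => le_max_right _ _
  set I : ℝ := ∫ s in Ico 0 T, gp s with hI_def
  have hgp_int : IntegrableOn gp (Ico 0 T) := hgi.pos_part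
  have hI0 : 0 ≤ I := setIntegral_nonneg measurableSet_Ico fun s _ => le_max_right _ _
  have hgpI : ∀ t ∈ Ico 0 T, ∫ s in (0:ℝ)..t, gp s ≤ I := by
    intro t ht
    rw [intervalIntegral.integral_of_le ht.1]
    refine setIntegral_mono_set hgp_int ?_ ?_
    · filter_upwards [ae_restrict_mem measurableSet_Ico] with s hs using hgp0 s hs
    · exact (show Ioc 0 t ⊆ Ico 0 T from fun s hs => ⟨hs.1.le, hs.2.trans_lt ht.2⟩).eventuallyLE
  /- (c) the engine on `K × [0,T)` with the level `L = C₀ν` -/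
  have key := radialMomentum_minPrinciple_engine_sublevel H (L := C₀ * ν) hgpc hgp0 hgpI
    (fun t ht x hx hx0 hlev hgrad hlap => by
      have h := hfl t ht x (lt_of_lt_of_le' (half_lt_self hδ) (le_of_lt (hx.2 : cylRadius x < δ / 2)))
        hx0 hlev hgrad hlap
      have : g t ≤ gp t := le_max_left _ _
      linarith)
    (fun t ht x hx => by
      by_cases hxR : R ≤ ‖x‖
      · exact hfarM t ht x hxR
      · have hxb : x ∈ ball (0 : EuclideanSpace ℝ (Fin 3)) R := mem_ball_zero_iff.2 (lt_of_not_ge hxR)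
        have hxr : δ / 2 ≤ cylRadius x := by
          by_contra hlt
          exact hx.2 ⟨hxb, lt_of_not_ge hlt⟩
        exact htube t ht x hxr)
    (fun x _ => hinit x)
  /- (d) conclusion on the half tube -/
  refine ⟨(max (δ / 2 * M) (C₀ * ν) + I) / ν, δ / 2, hδ2, fun t ht x hx => ?_⟩
  have hCν : (max (δ / 2 * M) (C₀ * ν) + I) / ν * ν = max (δ / 2 * M) (C₀ * ν) + I :=
    div_mul_cancel₀ _ hν.ne'
  rw [hCν]
  by_cases hxR : ‖x‖ ≤ R
  · exact key t ht x ⟨mem_closedBall_zero_iff.2 hxR, (le_of_lt hx : cylRadius x ≤ δ / 2)⟩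
  · have h1 := radialMomentum_ge_neg_mul_of_norm_le (le_of_lt hx) (hfarM t ht x (le_of_not_ge hxR))
    have h2 : δ / 2 * M ≤ max (δ / 2 * M) (C₀ * ν) := le_max_left _ _
    linarith

end Summit.NavierStokesRegularity.NavierStokesRegularity.Theorems

/-! ### The registered stub, verbatim -/

namespace Summit.NavierStokesRegularity.NavierStokesRegularity.Theorems.SupercriticalDefectFloor

-- the problem directory repeats the summit name (`NavierStokesRegularity/NavierStokesRegularity`)
set_option linter.dupNamespace false

open Summit.NavierStokesRegularity.NavierStokesRegularity.Theorems

/-- **Registered stub `stub_minPrinciple_sublevel` of the line `supercritical_defect_floor` (crux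
`AprioriRadialInflowBound`, stmt-NavierStokesRegularity-19060; piece X₂ of `AxisymSwirlRegular`,
stmt-NavierStokesRegularity-1964), signature VERBATIM.** In the standing class (classical on `[0,T)`,
Leray–Hopf from the datum, bounded on sub-slabs, axisymmetric slices, rapidly decaying datum): if for some
real `C₀`, some `δ > 0` and a continuous integrable `g` on `[0,T)` the cyclostrophic defect is `≥ -g(t)` at
every off-axis point of the tube `{cylRadius < δ}` that is a spatial critical point of `Φ(t,·) = x₀u₀ + x₁u₁`
with `ΔΦ(t,x) ≥ 0` and `Φ(t,x) ≤ -C₀ν`, then `Φ ≥ -Cν` on a thinner tube for all `t ∈ [0,T)`. Proof: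
`inflowBound_of_sublevelDefectFloor` (the rapid decay of the datum is not needed). [new; method:
Lieberman 1996 Ch. II Lemma 2.1 on the positivity set] -/
theorem stub_minPrinciple_sublevel {ν T : ℝ} (hν : 0 < ν) (hT : 0 < T)
    {u : ℝ → EuclideanSpace ℝ (Fin 3) → EuclideanSpace ℝ (Fin 3)} {p : ℝ → EuclideanSpace ℝ (Fin 3) → ℝ}
    (hcl : IsClassicalNSSolutionOn (Ico 0 T) ν 0 u p) (hLH : IsLerayHopfOn T ν 0 (u 0) u)
    (hbd : ∀ T' < T, ∃ M : ℝ, ∀ t ∈ Icc 0 T', ∀ x, ‖u t x‖ ≤ M)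
    (hax : ∀ t ∈ Ico 0 T, IsAxisymmetric (u t)) (hdec : HasRapidSpatialDecay (u 0))
    {C₀ δ : ℝ} (hδ : 0 < δ) {g : ℝ → ℝ} (hgc : ContinuousOn g (Ico 0 T)) (hgi : IntegrableOn g (Ico 0 T))
    (hfl : ∀ t ∈ Ico 0 T, ∀ x : EuclideanSpace ℝ (Fin 3), cylRadius x < δ → cylRadius x ≠ 0 →
      x 0 * u t x 0 + x 1 * u t x 1 ≤ -(C₀ * ν) →
      fderiv ℝ (fun z : EuclideanSpace ℝ (Fin 3) => z 0 * u t z 0 + z 1 * u t z 1) x = 0 →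
      0 ≤ (Δ (fun z : EuclideanSpace ℝ (Fin 3) => z 0 * u t z 0 + z 1 * u t z 1)) x →
      -g t ≤ (u t x 0) ^ 2 + (u t x 1) ^ 2
        - (x 0 * fderiv ℝ (p t) x (EuclideanSpace.single 0 1)
            + x 1 * fderiv ℝ (p t) x (EuclideanSpace.single 1 1))) :
    ∃ C δ' : ℝ, 0 < δ' ∧ ∀ t ∈ Ico 0 T, ∀ x : EuclideanSpace ℝ (Fin 3), cylRadius x < δ' →
      -(C * ν) ≤ x 0 * u t x 0 + x 1 * u t x 1 := by
  have _hdec := hdec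
  exact inflowBound_of_sublevelDefectFloor (⟨hν, hT, hcl, hLH, hbd, hax⟩ : AxisymmetricL3Hyp ν T u p) hδ hgc hgi hfl

end Summit.NavierStokesRegularity.NavierStokesRegularity.Theorems.SupercriticalDefectFloor

end
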